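import Mathlib.Topology.Sequences
import Mathlib.Topology.MetricSpace.ProperSpace
import Mathlib.Analysis.InnerProductSpace.PiL2
import HarnessLib

/-!
# LINE 25 «CompactnessTransfer» (crux `HistoryTailL` stmt-QuantumFields-19936 ∕ K2 crux `BlockLipschitzL` stmt-QuantumFields-23533), S2′ infrastructure (Γ1),
# FILE D: THE DIAGONAL SUBSEQUENCE BY TYCHONOFF — a countable family of bounded sequences in a proper metric space has ONE common convergent subsequence

Cell `ym3-torus` (YM ladder rung R3 = continuum SU(2) Yang–Mills on the three-torus — a RUNG, NOT the Clay problem: not d = 4, not infinite volume, not a mass gap);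
width seat `ym3-torus-px3` gen 7, the Γ1 seat.  The shape is ym3-torus-px14 g5's PROBE `PROBE-Gamma1-DiagonalSubseq.rc0.px14g5.lean` (98b1c546; LOCATE «Γ1 without
Kolmogorov–Riesz» §2 (ii) «all scales at once»), generalised from `Fin (N j) → ℝ⁴`-blocks in the unit ball to any countable index, any proper metric space and any radii —
credited here; used by the Γ1 knit for conjunct (c4) of `blowDown_L2_compact` (the dyadic block means of the rescaled discrete gradients, bounded by `√(8Λ₀)`).
THEOREMS ONLY (def-free); `--supports` the K2 crux as a helper.  Nothing here proves Γ1, S2′, the organ, `BlockLipschitzL`, `HistoryTailL` or any summit statement.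

* ★ `exists_subseq_tendsto_all` — `a : ℕ → ι → E`, `ι` countable, `E` proper, `dist (a k i) (c i) ≤ r i` ⇒ `∃ lim φ, StrictMono φ ∧ ∀ i, a (φ k) i → lim i`.
* `exists_subseq_tendsto_all_of_norm_le` — the normed-space form (`‖a k i‖ ≤ r i`).
Proof: the product `Π_i closedBall (c i) (r i)` is compact (`isCompact_univ_pi`), `ι → E` is first countable for countable `ι`, `IsCompact.tendsto_subseq`, and
coordinatewise convergence is convergence in the product topology (`continuous_apply`).  [folklore] (Tychonoff; the diagonal argument in one Mathlib call.)
-/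

set_option autoImplicit false

open Filter Topology

namespace Summit.QuantumFields.YangMills.Theorems.PoincareLipschitzDiagonalSubsequence

/-- ★ **THE DIAGONAL SUBSEQUENCE**: in a proper (pseudo)metric space, a countable family of sequences each confined to a fixed closed ball has ONE strictly increasing
`φ` along which EVERY member converges. [folklore] -/
theorem exists_subseq_tendsto_all {ι : Type*} [Countable ι] {E : Type*} [PseudoMetricSpace E] [ProperSpace E]
    (a : ℕ → ι → E) (c : ι → E) (r : ι → ℝ) (ha : ∀ k i, dist (a k i) (c i) ≤ r i) :
    ∃ (lim : ι → E) (φ : ℕ → ℕ), StrictMono φ ∧ ∀ i, Tendsto (fun k => a (φ k) i) atTop (𝓝 (lim i)) := by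
  let S : Set (ι → E) := Set.pi Set.univ fun i => Metric.closedBall (c i) (r i)
  have hS : IsCompact S := isCompact_univ_pi fun i => isCompact_closedBall _ _
  have hmem : ∀ k, a k ∈ S := fun k => by
    simp only [S, Set.mem_pi, Set.mem_univ, true_implies, Metric.mem_closedBall]
    exact fun i => ha k i
  obtain ⟨lim, -, φ, hφ, hlim⟩ := hS.tendsto_subseq hmem
  exact ⟨lim, φ, hφ, fun i => (continuous_apply i).continuousAt.tendsto.comp hlim⟩

/-- The normed-group form: `‖a k i‖ ≤ r i` for all `k, i` ⇒ a common convergent subsequence. [folklore] -/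
theorem exists_subseq_tendsto_all_of_norm_le {ι : Type*} [Countable ι] {E : Type*} [NormedAddCommGroup E] [ProperSpace E]
    (a : ℕ → ι → E) (r : ι → ℝ) (ha : ∀ k i, ‖a k i‖ ≤ r i) :
    ∃ (lim : ι → E) (φ : ℕ → ℕ), StrictMono φ ∧ ∀ i, Tendsto (fun k => a (φ k) i) atTop (𝓝 (lim i)) :=
  exists_subseq_tendsto_all a (fun _ => 0) r fun k i => by rw [dist_zero_right]; exact ha k i

end Summit.QuantumFields.YangMills.Theorems.PoincareLipschitzDiagonalSubsequence
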